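import Summits.MatrixMultiplication.MatrixMultiplication.Theorems.ThinPackings.Negative.FrameVolumeExcess
import Summits.MatrixMultiplication.MatrixMultiplication.Theorems.ThinPackings.Negative.FrameBlockVolume

/-!
# `FrameNoExcess` holds in the unit box: no `{0,±1}`-frame family has volume excess
(crux `ThinPackings`, stmt-MatrixMultiplication-10595; lead c2, line `three-sphere-frame-designs`, 2026-08-16)

Lead c1 conjectured and lead a1 formalised (`FrameVolumeExcess.lean`, `FrameNoExcess`) the kill criterion of
the two Euclidean-frame lines of the crux chain: a T/E/F-packed family of orthogonal frames in the box
`[-b, b]^D ⊂ ℤ^D` should have total block volume `Σᵢ |Aᵢ||Bᵢ||Cᵢ| ≤ (6b+1)^D` (the size of the carry-free host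
`(ℤ/(6b+1))^D`).  This file PROVES the criterion in the unit box `b = 1`, for all dimensions `D` and all
(rotated) frames:

  `Σᵢ |Aᵢ||Bᵢ||Cᵢ| ≤ (289/200 · 29/6)^D = 6.984…^D < 7^D`  (`frameNoExcess_one`, registered stub).

So no carry-free `{0,±1}`-frame family certifies `ω < 3` through CKSU (1.1), and the frame volume capacity at
`b = 1` satisfies `Θ₁ ≤ 3^{1/3}(2+2√2) = 6.9636 < 7` (searches of leads c1/a1: `Θ₁ ≥ V*(4,1)^{1/4} = 4.72`).

The proof is a1's tensor-stable LP certificate `volume_le_pow_of_coordPrice` with an explicit coordinatewise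
price, made valid by one arithmetic fact about orthogonal `{0,±1}`-vectors:

* `tile law` (`one_le_prod_omegaOne`): if `x ⊥ z` have entries in `{0,±1}` then the tile `z − x` has at least as
  many `0`-coordinates as `±2`-coordinates — because `x·z = #{j : xⱼ = zⱼ ≠ 0} − #{j : xⱼ = −zⱼ ≠ 0} = 0`, the
  `±2`-coordinates are exactly the second set and the first set consists of `0`-coordinates.  Hence the profile
  `ω = (ω₀, ω₁, ω₂) = (3/2, 1, 2/3)` pays every tile `∏ⱼ ω_{|tⱼ|} = (3/2)^{#0}(2/3)^{#2} ≥ 1`, at budget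
  `3/2 + 2·1 + 2·(2/3) = 29/6` per coordinate (the optimum of `1/θ + 2 + 2θ` is `2 + 2√2` at `θ = 1/√2`);
* `volume cap` (`frameBlock_card_le`, `FrameBlockVolume.lean`, p116459): pairwise-orthogonal legs span
  pairwise-orthogonal subspaces, so `|A||B||C| ≤ 3^{dim V_A + dim V_B + dim V_C} ≤ 3^D`;
* scaling the price by `K = 289/200` (`K³ = 3.017 ≥ 3`) turns "every tile costs ≥ K^D" and "V ≤ 3^D" into the
  cubic block inequality `V³ ≤ V²·3^D ≤ (|A||C|K^D)(|A||B|K^D)(|B||C|K^D) ≤ q(T)q(E)q(F)`, and the total price is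
  `(K · 29/6)^D = (8381/1200)^D ≤ 7^D`.

The method is sharp to within its means and dies at `b = 2` already (tile-law optimum `8.873^D` times cap
`5^{D/3}` exceeds `13^D`), see the lead's dossier `Cruxes/ThinPackings/Lines/three_sphere_frame_designs_dead.md`.
-/

set_option linter.dupNamespace false  -- `Summit.<S>.<S>.…` is the mandated namespace

namespace Summit.MatrixMultiplication.MatrixMultiplication.Theorems.ThinPackings.Negative

open Finset

section TileLaw

variable {D : ℕ}

/-- The unit-box price profile `ω = (3/2, 1, 2/3, 0, 0, …)` on absolute values of tile coordinates.
[new, elementary] -/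
noncomputable def omegaOne (u : ℕ) : ℝ :=
  if u = 0 then 3 / 2 else if u = 1 then 1 else if u = 2 then 2 / 3 else 0

/-- `ω ≥ 0`. [new, elementary] -/
theorem omegaOne_nonneg (u : ℕ) : 0 ≤ omegaOne u := by
  unfold omegaOne; split_ifs <;> norm_num

/-- An integer of absolute value `≤ 1` is `-1`, `0` or `1`. [folklore] -/
theorem eq_or_eq_or_eq_of_abs_le_one {a : ℤ} (h : |a| ≤ 1) : a = -1 ∨ a = 0 ∨ a = 1 := by
  rw [abs_le] at h; omega

/-- Coordinatewise form of `x·z` for `{0,±1}`-vectors: `xⱼzⱼ = [xⱼ = zⱼ ≠ 0] − [xⱼ = −zⱼ ≠ 0]`.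
[new, elementary] -/
theorem mul_eq_indicator_sub {a c : ℤ} (ha : |a| ≤ 1) (hc : |c| ≤ 1) :
    a * c = (if a = c ∧ a ≠ 0 then 1 else 0) - (if a = -c ∧ a ≠ 0 then 1 else 0) := by
  rcases eq_or_eq_or_eq_of_abs_le_one ha with rfl | rfl | rfl <;>
    rcases eq_or_eq_or_eq_of_abs_le_one hc with rfl | rfl | rfl <;> simp

/-- For orthogonal `{0,±1}`-vectors the numbers of coordinates with `xⱼ = zⱼ ≠ 0` and with `xⱼ = −zⱼ ≠ 0`
agree (they are the `+1` and `−1` contributions to `x·z = 0`). [new, elementary] -/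
theorem card_agree_eq_card_anti (x z : Fin D → ℤ) (hx : ∀ t, |x t| ≤ 1) (hz : ∀ t, |z t| ≤ 1)
    (h : x ⬝ᵥ z = 0) :
    (univ.filter fun t => x t = z t ∧ x t ≠ 0).card =
      (univ.filter fun t => x t = -z t ∧ x t ≠ 0).card := by
  have hsum : (x ⬝ᵥ z : ℤ) = ((univ.filter fun t => x t = z t ∧ x t ≠ 0).card : ℤ) -
      ((univ.filter fun t => x t = -z t ∧ x t ≠ 0).card : ℤ) := by
    rw [dotProduct, Finset.card_filter, Finset.card_filter]
    push_cast
    rw [← Finset.sum_sub_distrib]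
    exact Finset.sum_congr rfl fun t _ => mul_eq_indicator_sub (hx t) (hz t)
  rw [h] at hsum
  omega

/-- **Tile law.**  For orthogonal `{0,±1}`-vectors `x ⊥ z` the tile `z − x` costs at least `1` under the profile
`ω = (3/2, 1, 2/3)`: `∏ⱼ ω_{|zⱼ − xⱼ|} ≥ (3/2)^{#agree}·(2/3)^{#anti} = 1`. [new, elementary] -/
theorem one_le_prod_omegaOne (x z : Fin D → ℤ) (hx : ∀ t, |x t| ≤ 1) (hz : ∀ t, |z t| ≤ 1)
    (h : x ⬝ᵥ z = 0) : (1 : ℝ) ≤ ∏ t, omegaOne ((z - x) t).natAbs := by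
  -- comparison profile `ρ t = (3/2)^[agree] · (2/3)^[anti]`
  set ρ : Fin D → ℝ := fun t =>
    (3 / 2 : ℝ) ^ (if x t = z t ∧ x t ≠ 0 then 1 else 0) *
      (2 / 3 : ℝ) ^ (if x t = -z t ∧ x t ≠ 0 then 1 else 0) with hρ
  have hρω : ∀ t, ρ t ≤ omegaOne ((z - x) t).natAbs := by
    intro t
    simp only [hρ, Pi.sub_apply, omegaOne]
    rcases eq_or_eq_or_eq_of_abs_le_one (hx t) with h1 | h1 | h1 <;>
      rcases eq_or_eq_or_eq_of_abs_le_one (hz t) with h2 | h2 | h2 <;>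
        norm_num [h1, h2]
  have hρnn : ∀ t, 0 ≤ ρ t := fun t => by positivity
  have hprod : ∏ t, ρ t = 1 := by
    rw [hρ, Finset.prod_mul_distrib, Finset.prod_pow_eq_pow_sum, Finset.prod_pow_eq_pow_sum,
      ← Finset.card_filter, ← Finset.card_filter, card_agree_eq_card_anti x z hx hz h, ← mul_pow]
    norm_num
  calc (1 : ℝ) = ∏ t, ρ t := hprod.symm
    _ ≤ ∏ t, omegaOne ((z - x) t).natAbs := Finset.prod_le_prod (fun t _ => hρnn t) fun t _ => hρω t

end TileLaw

section One

variable {D L : ℕ}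

/-- The unit-box price: `K · ω` with `K = 289/200` (`K³ ≥ 3`, `K · 29/6 ≤ 7`). [new, elementary] -/
noncomputable def priceOne (u : ℕ) : ℝ := (289 / 200 : ℝ) * omegaOne u

/-- `priceOne ≥ 0`. [new, elementary] -/
theorem priceOne_nonneg (u : ℕ) : 0 ≤ priceOne u :=
  mul_nonneg (by norm_num) (omegaOne_nonneg u)

/-- Prices are nonnegative. [new, elementary] -/
theorem coordPrice_priceOne_nonneg (v : Fin D → ℤ) : 0 ≤ coordPrice priceOne v :=
  Finset.prod_nonneg fun _ _ => priceOne_nonneg _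

/-- Every tile of an orthogonal unit-box pair costs at least `K^D`. [new, elementary] -/
theorem pow_le_coordPrice_priceOne (x z : Fin D → ℤ) (hx : ∀ t, |x t| ≤ 1) (hz : ∀ t, |z t| ≤ 1)
    (h : x ⬝ᵥ z = 0) : (289 / 200 : ℝ) ^ D ≤ coordPrice priceOne (z - x) := by
  unfold coordPrice priceOne
  rw [Finset.prod_mul_distrib, Finset.prod_const, card_univ, Fintype.card_fin]
  have h1 := one_le_prod_omegaOne x z hx hz h
  have hK : (0 : ℝ) ≤ (289 / 200 : ℝ) ^ D := by positivity
  nlinarith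

/-- A double sum of tile prices over an orthogonal pair of unit-box legs is at least `|X|·|Z|·K^D`.
[new, elementary] -/
theorem card_mul_card_mul_pow_le_sum (X Z : Finset (Fin D → ℤ)) (hX : ∀ v ∈ X, ∀ t, |v t| ≤ (1 : ℤ))
    (hZ : ∀ v ∈ Z, ∀ t, |v t| ≤ (1 : ℤ)) (horth : ∀ x ∈ X, ∀ z ∈ Z, x ⬝ᵥ z = 0) :
    (X.card : ℝ) * Z.card * (289 / 200 : ℝ) ^ D ≤ ∑ x ∈ X, ∑ z ∈ Z, coordPrice priceOne (z - x) := by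
  calc (X.card : ℝ) * Z.card * (289 / 200 : ℝ) ^ D
      = ∑ _x ∈ X, ∑ _z ∈ Z, (289 / 200 : ℝ) ^ D := by
        rw [Finset.sum_const, Finset.sum_const, nsmul_eq_mul, nsmul_eq_mul]; ring
    _ ≤ ∑ x ∈ X, ∑ z ∈ Z, coordPrice priceOne (z - x) :=
        Finset.sum_le_sum fun x hx => Finset.sum_le_sum fun z hz =>
          pow_le_coordPrice_priceOne x z (hX x hx) (hZ z hz) (horth x hx z hz)

/-- The budget of the unit-box price over the tile alphabet `{-2,…,2}`: `K · 29/6`. [new, elementary] -/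
theorem sum_priceOne_Icc :
    ∑ u ∈ Icc (-2 : ℤ) 2, priceOne u.natAbs = (289 / 200 : ℝ) * (29 / 6) := by
  have hIcc : Icc (-2 : ℤ) 2 = {-2, -1, 0, 1, 2} := by
    ext u; simp only [mem_Icc, mem_insert, mem_singleton]; omega
  rw [hIcc]
  rw [Finset.sum_insert (by decide), Finset.sum_insert (by decide), Finset.sum_insert (by decide),
    Finset.sum_insert (by decide), Finset.sum_singleton]
  simp only [priceOne, omegaOne]
  norm_num

/-- **The unit-box bound, real form.**  Every family of orthogonal frames in `[-1, 1]^D ⊂ ℤ^D` with the three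
weak packings has `Σᵢ |Aᵢ||Bᵢ||Cᵢ| ≤ (289/200 · 29/6)^D = (8381/1200)^D ≈ 6.984^D`. [new, elementary] -/
theorem sum_volume_le_pow_one (A B C : Fin L → Finset (Fin D → ℤ))
    (hbox : ∀ i, (∀ v ∈ A i, ∀ t, |v t| ≤ (1 : ℤ)) ∧ (∀ v ∈ B i, ∀ t, |v t| ≤ (1 : ℤ)) ∧
      (∀ v ∈ C i, ∀ t, |v t| ≤ (1 : ℤ)))
    (hfr : (∀ i, ∀ x ∈ A i, ∀ y ∈ B i, x ⬝ᵥ y = 0) ∧ (∀ i, ∀ x ∈ A i, ∀ z ∈ C i, x ⬝ᵥ z = 0) ∧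
      (∀ i, ∀ y ∈ B i, ∀ z ∈ C i, y ⬝ᵥ z = 0))
    (hPD : ∀ i k, ∀ x ∈ A i, ∀ z ∈ C i, ∀ x' ∈ A k, ∀ z' ∈ C k, z - x = z' - x' → i = k)
    (hPE : ∀ i k, ∀ x ∈ A i, ∀ y ∈ B i, ∀ x' ∈ A k, ∀ y' ∈ B k, y - x = y' - x' → i = k)
    (hPF : ∀ i k, ∀ y ∈ B i, ∀ z ∈ C i, ∀ y' ∈ B k, ∀ z' ∈ C k, y - z = y' - z' → i = k) :
    (∑ i, (((A i).card * (B i).card * (C i).card : ℕ) : ℝ)) ≤ ((289 / 200 : ℝ) * (29 / 6)) ^ D := by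
  obtain ⟨hoAB, hoAC, hoBC⟩ := hfr
  -- the box hypothesis in the `(b : ℤ)`, `b = 1` shape of `volume_le_pow_of_coordPrice`
  have hbox' : ∀ i, (∀ v ∈ A i, ∀ t, |v t| ≤ ((1 : ℕ) : ℤ)) ∧ (∀ v ∈ B i, ∀ t, |v t| ≤ ((1 : ℕ) : ℤ)) ∧
      (∀ v ∈ C i, ∀ t, |v t| ≤ ((1 : ℕ) : ℤ)) := by
    simpa using hbox
  -- the cubic block inequality
  have hgeo : ∀ i, (((A i).card * (B i).card * (C i).card : ℕ) : ℝ) ^ 3 ≤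
      (∑ x ∈ A i, ∑ z ∈ C i, coordPrice priceOne (z - x)) *
        (∑ x ∈ A i, ∑ y ∈ B i, coordPrice priceOne (y - x)) *
        ∑ z ∈ C i, ∑ y ∈ B i, coordPrice priceOne (y - z) := by
    intro i
    obtain ⟨hbA, hbB, hbC⟩ := hbox i
    have hT := card_mul_card_mul_pow_le_sum (A i) (C i) hbA hbC (hoAC i)
    have hE := card_mul_card_mul_pow_le_sum (A i) (B i) hbA hbB (hoAB i)
    have hF := card_mul_card_mul_pow_le_sum (C i) (B i) hbC hbB
      (fun z hz y hy => by rw [dotProduct_comm]; exact hoBC i y hy z hz)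
    -- volume cap `V ≤ 3^D`
    have hcap : (A i).card * (B i).card * (C i).card ≤ 3 ^ D := by
      have := frameBlock_card_le D 1 (A i) (B i) (C i) (by simpa using hbA) (by simpa using hbB)
        (by simpa using hbC) (hoAB i) (hoAC i) (hoBC i)
      simpa using this
    set V : ℝ := (((A i).card * (B i).card * (C i).card : ℕ) : ℝ) with hV
    have hVnn : 0 ≤ V := by positivity
    have hcapR : V ≤ (3 : ℝ) ^ D := by
      rw [hV]; exact_mod_cast hcap
    have hK3 : (3 : ℝ) ^ D ≤ ((289 / 200 : ℝ) ^ D) ^ 3 := by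
      rw [← pow_mul, mul_comm, pow_mul]
      exact pow_le_pow_left₀ (by norm_num) (by norm_num) D
    set KD : ℝ := (289 / 200 : ℝ) ^ D with hKD
    have hKDnn : 0 ≤ KD := by positivity
    have ha : (0 : ℝ) ≤ (A i).card := Nat.cast_nonneg _
    have hb : (0 : ℝ) ≤ (B i).card := Nat.cast_nonneg _
    have hc : (0 : ℝ) ≤ (C i).card := Nat.cast_nonneg _
    calc V ^ 3 = V ^ 2 * V := by ring
      _ ≤ V ^ 2 * KD ^ 3 := by gcongr; exact hcapR.trans hK3
      _ = ((A i).card * (C i).card * KD) * ((A i).card * (B i).card * KD) *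
            ((C i).card * (B i).card * KD) := by rw [hV]; push_cast; ring
      _ ≤ (∑ x ∈ A i, ∑ z ∈ C i, coordPrice priceOne (z - x)) *
            (∑ x ∈ A i, ∑ y ∈ B i, coordPrice priceOne (y - x)) *
            ∑ z ∈ C i, ∑ y ∈ B i, coordPrice priceOne (y - z) := by
          have hTnn : 0 ≤ ∑ x ∈ A i, ∑ z ∈ C i, coordPrice priceOne (z - x) :=
            sum_nonneg fun _ _ => sum_nonneg fun _ _ => coordPrice_priceOne_nonneg _
          have hEnn : 0 ≤ ∑ x ∈ A i, ∑ y ∈ B i, coordPrice priceOne (y - x) :=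
            sum_nonneg fun _ _ => sum_nonneg fun _ _ => coordPrice_priceOne_nonneg _
          exact mul_le_mul (mul_le_mul hT hE (by positivity) hTnn) hF (by positivity)
            (mul_nonneg hTnn hEnn)
  have key := volume_le_pow_of_coordPrice priceOne priceOne_nonneg 1 A B C hbox' ⟨hoAB, hoAC, hoBC⟩
    hPD hPE hPF hgeo
  have hIcc1 : Icc (-(2 * ((1 : ℕ) : ℤ))) (2 * ((1 : ℕ) : ℤ)) = Icc (-2 : ℤ) 2 := by norm_num
  rw [hIcc1, sum_priceOne_Icc] at key
  exact key

/-- **`FrameNoExcess` at `b = 1`** (registered stub `frameNoExcess_one`).  Every family of orthogonal frames in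
the unit box `[-1, 1]^D ⊂ ℤ^D` with the three weak packings has total block volume `Σᵢ |Aᵢ||Bᵢ||Cᵢ| ≤ 7^D`
(`sum_volume_le_pow_one` and `8381/1200 < 7`). [new, elementary] -/
theorem frameNoExcess_one :
    ∀ (D L : ℕ) (A B C : Fin L → Finset (Fin D → ℤ)),
      (∀ i, (∀ v ∈ A i, ∀ t, |v t| ≤ (1 : ℤ)) ∧ (∀ v ∈ B i, ∀ t, |v t| ≤ (1 : ℤ)) ∧
        (∀ v ∈ C i, ∀ t, |v t| ≤ (1 : ℤ))) →
      ((∀ i, ∀ x ∈ A i, ∀ y ∈ B i, x ⬝ᵥ y = 0) ∧ (∀ i, ∀ x ∈ A i, ∀ z ∈ C i, x ⬝ᵥ z = 0) ∧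
        (∀ i, ∀ y ∈ B i, ∀ z ∈ C i, y ⬝ᵥ z = 0)) →
      (∀ i k, ∀ x ∈ A i, ∀ z ∈ C i, ∀ x' ∈ A k, ∀ z' ∈ C k, z - x = z' - x' → i = k) →
      (∀ i k, ∀ x ∈ A i, ∀ y ∈ B i, ∀ x' ∈ A k, ∀ y' ∈ B k, y - x = y' - x' → i = k) →
      (∀ i k, ∀ y ∈ B i, ∀ z ∈ C i, ∀ y' ∈ B k, ∀ z' ∈ C k, y - z = y' - z' → i = k) →
      ∑ i, (A i).card * (B i).card * (C i).card ≤ 7 ^ D := by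
  intro D L A B C hbox hfr hPD hPE hPF
  have key := sum_volume_le_pow_one A B C hbox hfr hPD hPE hPF
  have h7 : ((289 / 200 : ℝ) * (29 / 6)) ^ D ≤ (7 : ℝ) ^ D :=
    pow_le_pow_left₀ (by norm_num) (by norm_num) D
  have hfin : (∑ i, (((A i).card * (B i).card * (C i).card : ℕ) : ℝ)) ≤ (7 : ℝ) ^ D := key.trans h7
  exact_mod_cast hfin

end One

end Summit.MatrixMultiplication.MatrixMultiplication.Theorems.ThinPackings.Negative
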